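import Literature.IUT.HodgeTheaters.KitNFSide
import Literature.IUT.HodgeTheaters.KitS5LocalOfDatum

/-!
# `BaseThetaDatum.ofKitCore`: abc-iut-L5-t3's §4 datum BUILT FROM the kits ([IUTchI] Def 4.1, Ex 4.3–4.5, Def 6.1) —
# post-freeze additive D13 (converse dictionary C9-h⁻¹, part 2), not a cone member, not citable at 11:30Z

S. Mochizuki, *Inter-universal Teichmüller theory I*, kurims manuscript (May 2020), Definition 4.1 (i)–(vi) pp. 95–97,
Example 4.3 pp. 98–100, Example 4.4 pp. 105–107, Example 4.5 pp. 107–108, Definition 6.1 (v) p. 158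
([IUTchI] Def 4.1 p.95) [claim: Mochizuki2012, status: disputed] (claim key; HYPOTHESIS STRUCTURES + definitions; nothing
of the series is asserted, no side is taken on [IUTchIII] Cor. 3.12).

## What this file does (L5-lead RULINGS #31 (1); HOME/staging/L5/L5-t3/DESIGN-BaseThetaDatum-ofKit.md)

The three dictionaries of record go kit ← datum (`KitCore c`, `FKitCore fc`, `NFLink nl`).  Here the direction is
reversed: from abc-iut-L5-t4's base kit `K : PMBaseKit l`, the `C_K`-side NF kit `N : K.NFKit` (`KitNFSide.lean`), a
per-place mono-analytic binder `B : K.MonoBinder` (KIT-INSTANCE-SPEC §2 B1: the `𝒟^⊢_v` and `†𝒟_v ↦ †𝒟^⊢_v` of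
Def 4.1 (iii)(iv), which abc-iut-L5-t4's `MultKit` carries only strip-wise; supplied at D13 through `FKitLink` from
abc-iut-L5-t2's `HodgeTheaterModel`) and an evaluation-section binder `E : K.EvalBinder` (Example 4.4 (i)(ii): the
labelled classes of morphisms at `v ∈ 𝕍^bad`, with the zero label, Aut-bi-saturation and label rigidity — the
`(hrig)`, `(Z)` inputs of the design note, packaged), we DEFINE a §4 datum `BaseThetaDatum.ofKitCore` whose every
field is read off the kits: places = the kit's, `Amb v` = the LOCAL objects of the kit's ambient category,
`AmbG`/`HomNF`/labels/`labPull` = the NF kit's (so `exists_eq_phiNF` and the eleven functoriality laws are THEOREMS of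
`KitNFSide.lean`), and we prove that over it the dictionaries are identities: `KitCore.ofKit` (`e = id`, `amb = ι`,
`ambModel = Iso.refl`) and `NFLink.ofKit` (`homNF = Subtype.val`).  Consequently every abc-iut-L5-t3 theorem stated
over `(c : KitCore) (nl : NFLink c)` reads directly on the kits of record.  typed ≠ proved elsewhere; here every
declaration is a definition or a `rfl`-level identity.
-/

namespace Literature.IUT.HodgeTheaters

open CategoryTheory

universe u

namespace PMBaseKit

variable {l : ℕ} (K : PMBaseKit.{u} l)

/-- **B1 — the per-place mono-analytic binder** (HYPOTHESIS STRUCTURE): Def 4.1 (iii) "`†𝒟^⊢_v` is a category which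
admits an equivalence `†𝒟^⊢_v ⥲ 𝒟^⊢_v`" (resp. an object of `𝕋𝕄^⊢`), and Def 4.1 (iv) "to any `𝒟`-prime-strip `†𝔇`
one may associate, in a natural way, a `𝒟^⊢`-prime-strip `†𝔇^⊢` — the mono-analyticization", PLACE BY PLACE and
functorially in isomorphisms (abc-iut-L5-t3's `AmbM`/`DM`/`mono`/`monoIso` block over the kit's local objects).
([IUTchI] Def 4.1 (iv) p.96) [claim: Mochizuki2012, status: disputed] -/
structure MonoBinder where
  /-- the isomorphs `†𝒟^⊢_v` of `𝒟^⊢_v` at the kit place `x` -/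
  AmbM : K.V → Type u
  /-- category structure -/
  [catAmbM : ∀ x, Category.{u} (AmbM x)]
  /-- the model `𝒟^⊢_v` -/
  DM : ∀ x, AmbM x
  /-- all objects are isomorphs of `𝒟^⊢_v` -/
  nonempty_isoM : ∀ x (X Y : AmbM x), Nonempty (X ≅ Y)
  /-- mono-analyticization `†𝒟_v ↦ †𝒟^⊢_v` on local objects … -/
  mono : ∀ x, K.LocalObj x → AmbM x
  /-- … functorially in isomorphisms … -/
  monoIso : ∀ {x} {X Y : K.LocalObj x}, (X ≅ Y) → (mono x X ≅ mono x Y)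
  /-- … identities … -/
  monoIso_refl : ∀ {x} (X : K.LocalObj x), monoIso (Iso.refl X) = Iso.refl _
  /-- … composites. -/
  monoIso_trans : ∀ {x} {X Y Z : K.LocalObj x} (f : X ≅ Y) (g : Y ≅ Z), monoIso (f ≪≫ g) = monoIso f ≪≫ monoIso g

/-- The category structure on the isomorphs of `𝒟^⊢_v` carried by the binder. ([IUTchI] Def 4.1 (iii) p.96) [claim: Mochizuki2012, status: disputed] -/
instance MonoBinder.instCategoryAmbM (B : K.MonoBinder) (x : K.V) : Category.{u} (B.AmbM x) := B.catAmbM x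

/-- **The evaluation-section binder** (HYPOTHESIS STRUCTURE; the `(Z)` zero-label slot and the `(hrig)` rigidity law
of the design note, packaged with Example 4.4's classes): Example 4.4 (i) p. 105 "the various [classes of] morphisms
`𝒟_{v_j} → 𝒟_{>,v}` that arise [via the natural surjection `Π_v ↠ G_v`] from the evaluation sections labeled `j`",
`j ∈ |𝔽_l|` (the zero label included), (ii) "composing with arbitrary isomorphisms", every label occurring, and the
label of such a morphism being well defined ([EtTh] Cor. 2.9: automorphisms of `𝒟_v`, `v ∈ 𝕍^bad`, act trivially on
label classes of cusps — Remark 4.2.1) — over the kit's local objects at the kit's bad places.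
([IUTchI] Ex 4.4 (i) p.105) [claim: Mochizuki2012, status: disputed] -/
structure EvalBinder where
  /-- "`f : X → Y` arises from an evaluation section labelled `j ∈ |𝔽_l|`" (`v ∈ 𝕍^bad`, `X`, `Y` isomorphs of `𝒟_v`) -/
  IsEvalSection : ∀ {x : K.V}, x ∈ K.bad → FlAbs l → ∀ {X Y : K.LocalObj x}, (X.obj ⟶ Y.obj) → Prop
  /-- Ex 4.4 (ii): closed under pre-composition with isomorphisms … -/
  isoComp : ∀ {x} (hx : x ∈ K.bad) (j : FlAbs l) {X X' Y : K.LocalObj x} (a : X' ≅ X) (f : X.obj ⟶ Y.obj),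
    IsEvalSection hx j f → IsEvalSection hx j (a.hom.hom ≫ f)
  /-- … and post-composition with isomorphisms -/
  compIso : ∀ {x} (hx : x ∈ K.bad) (j : FlAbs l) {X Y Y' : K.LocalObj x} (f : X.obj ⟶ Y.obj) (b : Y ≅ Y'),
    IsEvalSection hx j f → IsEvalSection hx j (f ≫ b.hom.hom)
  /-- Ex 4.4 (i): every label occurs -/
  exists_section : ∀ {x} (hx : x ∈ K.bad) (j : FlAbs l) (X Y : K.LocalObj x), ∃ f : X.obj ⟶ Y.obj, IsEvalSection hx j f
  /-- the label is well defined (rigidity, [EtTh] Cor. 2.9 / Remark 4.2.1) -/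
  label_unique : ∀ {x} (hx : x ∈ K.bad) {j j' : FlAbs l} {X Y : K.LocalObj x} (f : X.obj ⟶ Y.obj),
    IsEvalSection hx j f → IsEvalSection hx j' f → j = j'

end PMBaseKit

namespace BaseThetaDatum

variable {l : ℕ}

/-- **`BaseThetaDatum.ofKitCore` — the §4 datum built from the kits** (the converse dictionary): places, bad and
archimedean places = the kit's; `Amb v` = the local objects of the kit's ambient category with `𝒟_v` = the kit's model;
the mono-analytic block = the binder `B`; `†𝒟^⊚`, `𝕍(†𝒟^⊚)`, `φ^NF`-type morphisms, the `𝔽_l^⋇`-torsors of label classes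
with `η_v`, `[ε]` and the label pull-back = the NF kit `N` (its laws are the theorems of `KitNFSide.lean`); evaluation
sections = the binder `E`.  Inputs not carried by any kit are explicit: `5 ≤ l` (Def 3.1 (c)), `𝕍^bad ∩ 𝕍^arc = ∅` and
`𝕍^bad ≠ ∅` (Def 3.1 (b)(e)). ([IUTchI] Def 4.1 p.95) [claim: Mochizuki2012, status: disputed] -/
noncomputable def ofKitCore (K : PMBaseKit.{u} l) [Fact l.Prime] (hl5 : 5 ≤ l) (hba : ∀ x ∈ K.bad, x ∉ K.arc)
    (hb : K.bad.Nonempty) (N : K.NFKit) (B : K.MonoBinder) (E : K.EvalBinder) : BaseThetaDatum.{u} where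
  l := l
  five_le_l := hl5
  V := K.V
  IsArc x := x ∈ K.arc
  IsBad x := x ∈ K.bad
  not_isArc_of_isBad := fun {x} hx => hba x hx
  exists_isBad := hb
  Amb x := K.LocalObj x
  D x := K.localModel x
  nonempty_iso _ X Y := ⟨(ObjectProperty.fullyFaithfulι _).preimageIso (X.property.some ≪≫ Y.property.some.symm)⟩
  AmbM := B.AmbM
  DM := B.DM
  nonempty_isoM := B.nonempty_isoM
  mono := B.mono
  monoIso := B.monoIso
  monoIso_refl := B.monoIso_refl
  monoIso_trans := B.monoIso_trans
  AmbG := N.GlobNF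
  DG := N.gnfModel
  nonempty_isoG := N.gnf_iso
  Val := N.Val
  valIso := N.valIso
  valIso_refl := N.valIso_refl
  valIso_trans := N.valIso_trans
  valOfV := N.valOfV
  HomNF := N.HomNF
  preNF := N.preNF
  postNF := N.postNF
  preNF_refl := N.preNF_refl
  preNF_trans := N.preNF_trans
  postNF_refl := N.postNF_refl
  postNF_trans := N.postNF_trans
  preNF_postNF := N.preNF_postNF
  phiNF := N.phiNF'
  exists_eq_phiNF := N.exists_eq_phiNF
  LabCusp := N.LabStar
  isTorsor_labCusp := N.isTorsor_labStar
  labIso := N.labStarIso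
  labIso_smul := N.labStarIso_smul
  labIso_refl := N.labStarIso_refl
  labIso_trans := N.labStarIso_trans
  η := N.ηStar
  labIso_η := N.labStarIso_η
  LabCuspG := N.GLabNF
  isTorsor_labCuspG := N.isTorsor_gLabNF
  labIsoG := N.gLabNFMap
  labIsoG_smul := N.gLabNFMap_smul
  labIsoG_refl := N.gLabNFMap_refl
  labIsoG_trans := N.gLabNFMap_trans
  εLab := N.εLab
  exists_aut_smul := N.exists_aut_smul
  labPull := N.labPullNF
  labPull_smul := N.labPullNF_smul
  labPull_preNF := N.labPullNF_preNF
  labPull_postNF := N.labPullNF_postNF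
  labPull_phiNF_εLab := N.labPullNF_phiNF'_εLab
  IsEvalSection hx j _ _ f := E.IsEvalSection hx j f.hom
  isEvalSection_isoComp hx j _ _ _ a f h := E.isoComp hx j a f.hom h
  isEvalSection_compIso hx j _ _ _ f b h := E.compIso hx j f.hom b h
  exists_isEvalSection hx j X Y := by
    obtain ⟨f, hf⟩ := E.exists_section hx j X Y
    exact ⟨ObjectProperty.homMk f, hf⟩
  isEvalSection_label_unique hx _ _ _ _ f h h' := E.label_unique hx f.hom h h'

variable (K : PMBaseKit.{u} l) [Fact l.Prime] (hl5 : 5 ≤ l) (hba : ∀ x ∈ K.bad, x ∉ K.arc) (hb : K.bad.Nonempty)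
  (N : K.NFKit) (B : K.MonoBinder) (E : K.EvalBinder)

/-- The datum's prime is the kit's `l`. ([IUTchI] Def 4.1 p.95) [claim: Mochizuki2012, status: disputed] -/
theorem ofKitCore_l : (ofKitCore K hl5 hba hb N B E).l = l := rfl

/-- **`KitCore.ofKit` — over the datum built from the kits, the `𝒟`-level dictionary is the identity**: `e = id`,
`amb v` = the inclusion of the local objects, `ambModel = Iso.refl`. ([IUTchI] Def 6.1 p.156) [claim: Mochizuki2012, status: disputed] -/
noncomputable def KitCore.ofKit : (ofKitCore K hl5 hba hb N B E).KitCore K where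
  e := Function.Embedding.refl _
  mem_bad_iff _ := Iff.rfl
  mem_arc_iff _ := Iff.rfl
  amb x := ObjectProperty.ι (K.IsLocal x)
  ambFF x := ObjectProperty.fullyFaithfulι (K.IsLocal x)
  ambModel _ := Iso.refl _

/-- The comparison functor of `KitCore.ofKit` is the inclusion of the local objects (definitional).
([IUTchI] Def 6.1 p.156) [claim: Mochizuki2012, status: disputed] -/
theorem KitCore.ofKit_amb (x : K.V) : (KitCore.ofKit K hl5 hba hb N B E).amb x = ObjectProperty.ι (K.IsLocal x) := rfl

/-- The model identification of `KitCore.ofKit` is the identity (definitional).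
([IUTchI] Def 6.1 p.156) [claim: Mochizuki2012, status: disputed] -/
theorem KitCore.ofKit_ambModel (x : K.V) : (KitCore.ofKit K hl5 hba hb N B E).ambModel x = Iso.refl _ := rfl

/-- **`NFLink.ofKit` — over the datum built from the kits, the `φ^NF` dictionary is the identity**: `nfAtV` = the NF
kit's, `homNF = Subtype.val` (a `φ^NF`-type morphism IS its underlying kit morphism); the two compatibility laws hold
by `rfl`. ([IUTchI] Ex 4.3 (ii) p.99) [claim: Mochizuki2012, status: disputed] -/
noncomputable def NFLink.ofKit : (KitCore.ofKit K hl5 hba hb N B E).NFLink where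
  nfAtV := N.nfAtV
  homNF _ _ _ f := f.1
  homNF_injective _ _ _ := Subtype.val_injective
  homNF_preNF _ _ _ _ _ _ := rfl
  homNF_postNF _ _ _ _ _ _ := rfl

/-- `NFLink.ofKit` forgets nothing: its `homNF` is the subtype inclusion (definitional).
([IUTchI] Ex 4.3 (ii) p.99) [claim: Mochizuki2012, status: disputed] -/
theorem NFLink.ofKit_homNF (x : K.V) (X : K.LocalObj x) (Y : N.GlobNF) (f : N.HomNF x X Y) :
    (NFLink.ofKit K hl5 hba hb N B E).homNF x X Y f = f.1 := rfl

end BaseThetaDatum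

end Literature.IUT.HodgeTheaters
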